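import Summits.AtomisticToContinuum.Crystallization.Theorems.SquareWellLayerCakeGapTwelveToBarlowCombinatorialLayeringTransportFinitePlane
import Summits.AtomisticToContinuum.Crystallization.Theorems.SquareWellLayerCakeGapTwelveToBarlowCombinatorialLayeringTransportFiniteLayers
import Summits.AtomisticToContinuum.Crystallization.Theorems.PalmUnimodularRigidityShellsToBarlowChartTransportGlobalC
import Summits.AtomisticToContinuum.Crystallization.Theorems.PalmUnimodularRigidityShellsToBarlowChartTransportGlobalA
import Summits.AtomisticToContinuum.Crystallization.Theorems.PalmUnimodularRigidityShellsToBarlowChartTransportGlobalB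
import Summits.AtomisticToContinuum.Crystallization.Theorems.PalmUnimodularRigidityShellsToBarlowChartTransportGlobalF
import Summits.AtomisticToContinuum.Crystallization.Theorems.PalmUnimodularRigidityShellsToBarlowChartTransportGlobalE
import Summits.AtomisticToContinuum.Crystallization.Theorems.PalmUnimodularRigidityShellsToBarlowChartTransportGlobalD

/-!
# Combinatorial layering (B1a of `GapTwelveToBarlow`): the finite stack of layers (graded `layers`)

Crux `SquareWellLayerCake.GapTwelveToBarlow` (stmt-AtomisticToContinuum-15807), line `Sketch`,
stub `stub_combinatorialLayering`, residual `(H_develop)`; fourth piece of the FINITE DEVELOPMENT: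
the graded analogue of 9227's `layers` (`…TransportGlobalC`).  From a valid frame `g₀` of parity
`+1` in the base regime at level `n + K + 4 + R`, the development
`frameAt g₀ k i j = V^k (I^i (J^j g₀))` is, for every layer `k ≤ K` (upward; `layersDownFin` for
`V⁻¹`), VALID on the diamond `|j| + |i| + 3k ≤ R`, at level `n + (K − k) + (R − |j| − |i|) + 4`,
COHERENT in the layer (`I`- and `J`-recurrences one inside the boundary) and, across layers, the
letter read below layer `k + 1` is the parity of layer `k` — by induction on `k` from the finite
base plane (`planeFin`) with one layer up per step (`layerUpFin`), the diamond shrinking by `3` and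
the level by `1` per layer.  All `[folklore]`.
-/

noncomputable section

namespace Summit.AtomisticToContinuum.Crystallization.Theorems.SquareWellLayerCakeGapTwelveToBarlow

open Literature.Geometry.DiscreteGeometry Literature.MathematicalPhysics.StatisticalMechanics
open Summit.AtomisticToContinuum.Crystallization.Theorems.PalmUnimodularRigidityShellsToBarlowChart hiding
  IsZChart TransportSystem scales_tied sqNormInt_transfer bond_symm nb_mem zlab_spec zlab_nb
  bond_nb_iff pattern_cases transfer_nb_nb transfer_nb_centre transfer_nb_target
  sqNormInt_zlab_centre hcp_of_mirror_pair Istep_spec Jstep_spec IinvStep_spec JinvStep_spec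
  capWithAny_of_mem_cap IinvStep_Istep Istep_IinvStep JinvStep_Jstep Jstep_JinvStep polar_at_apex
  onesided_at_apex Vstep_spec nb_inj Istep_lower Jstep_lower IinvStep_lower JinvStep_lower
  polar_at_lower_apex onesided_at_lower_apex VinvStep_spec attach_I_even attach_I_odd
  attach_lower_I_pos attach_lower_I_neg attach_J_even attach_J_odd Vstep_Istep_pt Vstep_Istep_back
  Vstep_Istep_side Vstep_Jstep_pt Vstep_Istep_comm Vstep_Jstep_comm attach_lower_J_pos
  attach_lower_J_neg VinvStep_Istep_pt VinvStep_Jstep_pt VinvStep_Istep_back VinvStep_Istep_side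
  VinvStep_Istep_comm VinvStep_Jstep_comm Istep_Jstep_comm layers back_I back_J nbhd layer_up
  layer_down line_I line_J adm_transports layer_zero sites par_IJ lowerParity_eq_par_below star_at
  sites_inlayer up_of_V up_of_Vinv down_of_Vinv down_of_V star_core table_fcc_p table_fcc_m
  table_hcp_p table_hcp_m

variable {S : ℕ → Set (EuclideanSpace ℝ (Fin 3))}
  {B : EuclideanSpace ℝ (Fin 3) → EuclideanSpace ℝ (Fin 3) → Prop}
  {Pc : EuclideanSpace ℝ (Fin 3) → Finset (Fin 3 → ℤ)}
  {nb : EuclideanSpace ℝ (Fin 3) → (Fin 3 → ℤ) → EuclideanSpace ℝ (Fin 3)}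

variable
  (hch : (∀ n : ℕ, ∀ z ∈ S n, (Pc z = fcc3Int ∨ Pc z = hcpInt) ∧
      Set.BijOn (nb z) (↑(Pc z) : Set (Fin 3 → ℤ)) {y | B z y} ∧
      ∀ t ∈ Pc z, ∀ t' ∈ Pc z, (B (nb z t) (nb z t') ↔ sqNormInt (t - t') = 18)) ∧
    (∀ n : ℕ, ∀ z ∈ S (n + 1), ∀ y, B z y → y ∈ S n) ∧
    (∀ n m : ℕ, ∀ x ∈ S n, ∀ y ∈ S m, B x y →
      ∀ (z z' : EuclideanSpace ℝ (Fin 3)) (t t' u u' : Fin 3 → ℤ),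
        (t = 0 ∧ z = x ∨ t ∈ Pc x ∧ z = nb x t) → (t' = 0 ∧ z' = x ∨ t' ∈ Pc x ∧ z' = nb x t') →
        (u = 0 ∧ z = y ∨ u ∈ Pc y ∧ z = nb y u) → (u' = 0 ∧ z' = y ∨ u' ∈ Pc y ∧ z' = nb y u') →
        sqNormInt (u - u') = sqNormInt (t - t')) ∧
    (∀ x y, B x y → B y x))

include hch



/-- **The finite stack, upward** (graded `layers`, `V`-half): validity, level and in-layer
coherence of layer `k ≤ K` on the diamond `|j| + |i| + 3k ≤ R`, and the letters across layers.
[folklore] -/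
theorem layersUpFin {n K R : ℕ} {g₀ : ZFrame} (h₀ : IsFrame (Pc g₀.pt) g₀.t₁ g₀.t₂ g₀.U)
    (h₀S : g₀.pt ∈ S (n + K + 4 + R)) (h₀p : frameParity g₀.t₁ g₀.t₂ g₀.U = 1)
    (h₀A : (∀ m, ∀ z ∈ S m, Pc z = fcc3Int) ∨ Pc g₀.pt = hcpInt) (hKR : 3 * K ≤ R) :
    ∀ k : ℕ, k ≤ K →
      ((∀ i j : ℤ, j.natAbs + i.natAbs + 3 * k ≤ R →
        IsFrame (Pc (frameAt Pc nb g₀ (k : ℤ) i j).pt) (frameAt Pc nb g₀ (k : ℤ) i j).t₁ (frameAt Pc nb g₀ (k : ℤ) i j).t₂ (frameAt Pc nb g₀ (k : ℤ) i j).U ∧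
          (frameAt Pc nb g₀ (k : ℤ) i j).pt ∈ S (n + (K - k) + (R - j.natAbs - i.natAbs) + 4)) ∧
      (∀ i j : ℤ, j.natAbs + i.natAbs + 3 * k + 1 ≤ R →
        frameAt Pc nb g₀ (k : ℤ) (i + 1) j = Istep Pc nb (frameAt Pc nb g₀ (k : ℤ) i j)) ∧
      (∀ i j : ℤ, j.natAbs + 1 + i.natAbs + 3 * k ≤ R →
        frameAt Pc nb g₀ (k : ℤ) i (j + 1) = Jstep Pc nb (frameAt Pc nb g₀ (k : ℤ) i j))) ∧
      (∀ i j : ℤ, j.natAbs + i.natAbs + 3 * (k + 1) ≤ R → k + 1 ≤ K →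
        lowerParity (frameAt Pc nb g₀ ((k : ℤ) + 1) i j).t₁ (frameAt Pc nb g₀ ((k : ℤ) + 1) i j).t₂
            (lowerCap (Pc (frameAt Pc nb g₀ ((k : ℤ) + 1) i j).pt) (frameAt Pc nb g₀ ((k : ℤ) + 1) i j).t₁
              (frameAt Pc nb g₀ ((k : ℤ) + 1) i j).t₂ (frameAt Pc nb g₀ ((k : ℤ) + 1) i j).U) =
          frameParity (frameAt Pc nb g₀ (k : ℤ) i j).t₁ (frameAt Pc nb g₀ (k : ℤ) i j).t₂ (frameAt Pc nb g₀ (k : ℤ) i j).U) := by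
  -- the invariant alone, by induction
  have inv : ∀ k : ℕ, k ≤ K →
      ((∀ i j : ℤ, j.natAbs + i.natAbs + 3 * k ≤ R →
        IsFrame (Pc (frameAt Pc nb g₀ (k : ℤ) i j).pt) (frameAt Pc nb g₀ (k : ℤ) i j).t₁ (frameAt Pc nb g₀ (k : ℤ) i j).t₂ (frameAt Pc nb g₀ (k : ℤ) i j).U ∧
          (frameAt Pc nb g₀ (k : ℤ) i j).pt ∈ S (n + (K - k) + (R - j.natAbs - i.natAbs) + 4)) ∧
      (∀ i j : ℤ, j.natAbs + i.natAbs + 3 * k + 1 ≤ R →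
        frameAt Pc nb g₀ (k : ℤ) (i + 1) j = Istep Pc nb (frameAt Pc nb g₀ (k : ℤ) i j)) ∧
      (∀ i j : ℤ, j.natAbs + 1 + i.natAbs + 3 * k ≤ R →
        frameAt Pc nb g₀ (k : ℤ) i (j + 1) = Jstep Pc nb (frameAt Pc nb g₀ (k : ℤ) i j))) := by
    intro k
    induction k with
    | zero =>
      intro _
      have el : n + K + 4 + R = (n + K + 1) + 3 + R := by omega
      rw [el] at h₀S
      obtain ⟨hv, hIc, hJc⟩ := planeFin hch h₀ h₀S h₀p h₀A
      refine ⟨fun i j h => ?_, fun i j h => ?_, fun i j h => ?_⟩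
      · obtain ⟨h1, h2, -, -⟩ := hv i j (by omega)
        have el' : n + K + 1 + 3 + (R - j.natAbs - i.natAbs) = n + (K - 0) + (R - j.natAbs - i.natAbs) + 4 := by
          omega
        rw [el'] at h2
        exact ⟨h1, h2⟩
      · exact hIc i j (by omega)
      · exact hJc i j (by omega)
    | succ k ih =>
      intro hk
      obtain ⟨hv, hIc, hJc⟩ := ih (by omega)
      have up := layerUpFin hch (R := R - 3 * k) (L := fun i j => n + (K - k) + (R - j.natAbs - i.natAbs))
        (Φ := fun i j => frameAt Pc nb g₀ (k : ℤ) i j)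
        (fun i j h => (hv i j (by omega)).1) (fun i j h => (hv i j (by omega)).2)
        (fun i j h => hIc i j (by omega)) (fun i j h => hJc i j (by omega))
      obtain ⟨uv, uS, uI, uJ, -⟩ := up
      have eF : ∀ i j : ℤ, frameAt Pc nb g₀ ((k + 1 : ℕ) : ℤ) i j = Vstep Pc nb (frameAt Pc nb g₀ (k : ℤ) i j) := by
        intro i j; push_cast; exact frameAt_natSucc g₀ k i j
      refine ⟨fun i j h => ?_, fun i j h => ?_, fun i j h => ?_⟩
      · rw [eF]
        refine ⟨uv i j (by omega), ?_⟩
        have := uS i j (by omega)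
        have el : n + (K - k) + (R - j.natAbs - i.natAbs) + 3 = n + (K - (k + 1)) + (R - j.natAbs - i.natAbs) + 4 := by
          omega
        rw [el] at this
        exact this
      · rw [eF, eF]; exact uI i j (by omega) (by omega)
      · rw [eF, eF]; exact uJ i j (by omega) (by omega)
  intro k hk
  refine ⟨inv k hk, fun i j h hk1 => ?_⟩
  obtain ⟨hv, hIc, hJc⟩ := inv k hk
  have up := layerUpFin hch (R := R - 3 * k) (L := fun i j => n + (K - k) + (R - j.natAbs - i.natAbs))
    (Φ := fun i j => frameAt Pc nb g₀ (k : ℤ) i j)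
    (fun i j h => (hv i j (by omega)).1) (fun i j h => (hv i j (by omega)).2)
    (fun i j h => hIc i j (by omega)) (fun i j h => hJc i j (by omega))
  have := up.2.2.2.2 i j (by omega)
  rw [frameAt_natSucc]
  exact this

/-- **The finite stack, downward** (graded `layers`, `V⁻¹`-half): validity, level and in-layer
coherence of layer `k ≤ K` on the diamond `|j| + |i| + 3k ≤ R`, and the letters across layers.
[folklore] -/
theorem layersDownFin {n K R : ℕ} {g₀ : ZFrame} (h₀ : IsFrame (Pc g₀.pt) g₀.t₁ g₀.t₂ g₀.U)
    (h₀S : g₀.pt ∈ S (n + K + 4 + R)) (h₀p : frameParity g₀.t₁ g₀.t₂ g₀.U = 1)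
    (h₀A : (∀ m, ∀ z ∈ S m, Pc z = fcc3Int) ∨ Pc g₀.pt = hcpInt) (hKR : 3 * K ≤ R) :
    ∀ k : ℕ, k ≤ K →
      ((∀ i j : ℤ, j.natAbs + i.natAbs + 3 * k ≤ R →
        IsFrame (Pc (frameAt Pc nb g₀ (-(k : ℤ)) i j).pt) (frameAt Pc nb g₀ (-(k : ℤ)) i j).t₁ (frameAt Pc nb g₀ (-(k : ℤ)) i j).t₂ (frameAt Pc nb g₀ (-(k : ℤ)) i j).U ∧
          (frameAt Pc nb g₀ (-(k : ℤ)) i j).pt ∈ S (n + (K - k) + (R - j.natAbs - i.natAbs) + 4)) ∧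
      (∀ i j : ℤ, j.natAbs + i.natAbs + 3 * k + 1 ≤ R →
        frameAt Pc nb g₀ (-(k : ℤ)) (i + 1) j = Istep Pc nb (frameAt Pc nb g₀ (-(k : ℤ)) i j)) ∧
      (∀ i j : ℤ, j.natAbs + 1 + i.natAbs + 3 * k ≤ R →
        frameAt Pc nb g₀ (-(k : ℤ)) i (j + 1) = Jstep Pc nb (frameAt Pc nb g₀ (-(k : ℤ)) i j))) ∧
      (∀ i j : ℤ, j.natAbs + i.natAbs + 3 * (k + 1) ≤ R → k + 1 ≤ K →
        frameParity (frameAt Pc nb g₀ (-((k : ℤ) + 1)) i j).t₁ (frameAt Pc nb g₀ (-((k : ℤ) + 1)) i j).t₂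
            (frameAt Pc nb g₀ (-((k : ℤ) + 1)) i j).U =
          lowerParity (frameAt Pc nb g₀ (-(k : ℤ)) i j).t₁ (frameAt Pc nb g₀ (-(k : ℤ)) i j).t₂
            (lowerCap (Pc (frameAt Pc nb g₀ (-(k : ℤ)) i j).pt) (frameAt Pc nb g₀ (-(k : ℤ)) i j).t₁
              (frameAt Pc nb g₀ (-(k : ℤ)) i j).t₂ (frameAt Pc nb g₀ (-(k : ℤ)) i j).U)) := by
  -- the invariant alone, by induction
  have inv : ∀ k : ℕ, k ≤ K →
      ((∀ i j : ℤ, j.natAbs + i.natAbs + 3 * k ≤ R →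
        IsFrame (Pc (frameAt Pc nb g₀ (-(k : ℤ)) i j).pt) (frameAt Pc nb g₀ (-(k : ℤ)) i j).t₁ (frameAt Pc nb g₀ (-(k : ℤ)) i j).t₂ (frameAt Pc nb g₀ (-(k : ℤ)) i j).U ∧
          (frameAt Pc nb g₀ (-(k : ℤ)) i j).pt ∈ S (n + (K - k) + (R - j.natAbs - i.natAbs) + 4)) ∧
      (∀ i j : ℤ, j.natAbs + i.natAbs + 3 * k + 1 ≤ R →
        frameAt Pc nb g₀ (-(k : ℤ)) (i + 1) j = Istep Pc nb (frameAt Pc nb g₀ (-(k : ℤ)) i j)) ∧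
      (∀ i j : ℤ, j.natAbs + 1 + i.natAbs + 3 * k ≤ R →
        frameAt Pc nb g₀ (-(k : ℤ)) i (j + 1) = Jstep Pc nb (frameAt Pc nb g₀ (-(k : ℤ)) i j))) := by
    intro k
    induction k with
    | zero =>
      intro _
      have el : n + K + 4 + R = (n + K + 1) + 3 + R := by omega
      rw [el] at h₀S
      obtain ⟨hv, hIc, hJc⟩ := planeFin hch h₀ h₀S h₀p h₀A
      refine ⟨fun i j h => ?_, fun i j h => ?_, fun i j h => ?_⟩
      · obtain ⟨h1, h2, -, -⟩ := hv i j (by omega)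
        have el' : n + K + 1 + 3 + (R - j.natAbs - i.natAbs) = n + (K - 0) + (R - j.natAbs - i.natAbs) + 4 := by
          omega
        rw [el'] at h2
        exact ⟨h1, h2⟩
      · exact hIc i j (by omega)
      · exact hJc i j (by omega)
    | succ k ih =>
      intro hk
      obtain ⟨hv, hIc, hJc⟩ := ih (by omega)
      have up := layerDownFin hch (R := R - 3 * k) (L := fun i j => n + (K - k) + (R - j.natAbs - i.natAbs))
        (Φ := fun i j => frameAt Pc nb g₀ (-(k : ℤ)) i j)
        (fun i j h => (hv i j (by omega)).1) (fun i j h => (hv i j (by omega)).2)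
        (fun i j h => hIc i j (by omega)) (fun i j h => hJc i j (by omega))
      obtain ⟨uv, uS, uI, uJ, -⟩ := up
      have eF : ∀ i j : ℤ, frameAt Pc nb g₀ (-((k + 1 : ℕ) : ℤ)) i j = VinvStep Pc nb (frameAt Pc nb g₀ (-(k : ℤ)) i j) := by
        intro i j; push_cast; exact frameAt_negSucc g₀ k i j
      refine ⟨fun i j h => ?_, fun i j h => ?_, fun i j h => ?_⟩
      · rw [eF]
        refine ⟨uv i j (by omega), ?_⟩
        have := uS i j (by omega)
        have el : n + (K - k) + (R - j.natAbs - i.natAbs) + 3 = n + (K - (k + 1)) + (R - j.natAbs - i.natAbs) + 4 := by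
          omega
        rw [el] at this
        exact this
      · rw [eF, eF]; exact uI i j (by omega) (by omega)
      · rw [eF, eF]; exact uJ i j (by omega) (by omega)
  intro k hk
  refine ⟨inv k hk, fun i j h hk1 => ?_⟩
  obtain ⟨hv, hIc, hJc⟩ := inv k hk
  have up := layerDownFin hch (R := R - 3 * k) (L := fun i j => n + (K - k) + (R - j.natAbs - i.natAbs))
    (Φ := fun i j => frameAt Pc nb g₀ (-(k : ℤ)) i j)
    (fun i j h => (hv i j (by omega)).1) (fun i j h => (hv i j (by omega)).2)
    (fun i j h => hIc i j (by omega)) (fun i j h => hJc i j (by omega))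
  have := up.2.2.2.2 i j (by omega)
  rw [frameAt_negSucc]
  exact this


/-- **The finite stack, `ℤ`-indexed**: layer `k`, `|k| ≤ K`, is valid, at level
`n + (K − |k|) + (R − |j| − |i|) + 4` and `I`/`J`-coherent on the diamond `|j| + |i| + 3|k| ≤ R`.
[folklore] -/
theorem layersFin_int {n K R : ℕ} {g₀ : ZFrame} (h₀ : IsFrame (Pc g₀.pt) g₀.t₁ g₀.t₂ g₀.U)
    (h₀S : g₀.pt ∈ S (n + K + 4 + R)) (h₀p : frameParity g₀.t₁ g₀.t₂ g₀.U = 1)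
    (h₀A : (∀ m, ∀ z ∈ S m, Pc z = fcc3Int) ∨ Pc g₀.pt = hcpInt) (hKR : 3 * K ≤ R) :
    ∀ k : ℤ, k.natAbs ≤ K →
      (∀ i j : ℤ, j.natAbs + i.natAbs + 3 * k.natAbs ≤ R →
        IsFrame (Pc (frameAt Pc nb g₀ k i j).pt) (frameAt Pc nb g₀ k i j).t₁ (frameAt Pc nb g₀ k i j).t₂ (frameAt Pc nb g₀ k i j).U ∧
          (frameAt Pc nb g₀ k i j).pt ∈ S (n + (K - k.natAbs) + (R - j.natAbs - i.natAbs) + 4)) ∧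
      (∀ i j : ℤ, j.natAbs + i.natAbs + 3 * k.natAbs + 1 ≤ R →
        frameAt Pc nb g₀ k (i + 1) j = Istep Pc nb (frameAt Pc nb g₀ k i j)) ∧
      (∀ i j : ℤ, j.natAbs + 1 + i.natAbs + 3 * k.natAbs ≤ R →
        frameAt Pc nb g₀ k i (j + 1) = Jstep Pc nb (frameAt Pc nb g₀ k i j)) := by
  intro k hk
  rcases int_cases k with ⟨m, rfl⟩ | ⟨m, rfl⟩
  · rw [Int.natAbs_natCast] at hk ⊢
    exact (layersUpFin hch h₀ h₀S h₀p h₀A hKR m hk).1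
  · have habs : (-((m : ℤ) + 1)).natAbs = m + 1 := by
      rw [Int.natAbs_neg]; exact Int.natAbs_natCast (m + 1)
    rw [habs] at hk ⊢
    have := (layersDownFin hch h₀ h₀S h₀p h₀A hKR (m + 1) hk).1
    push_cast at this
    exact this

/-- **Letters across layers, `ℤ`-indexed** (graded `lowerParity_eq_par_below`): the letter read
below layer `k` is the parity of layer `k − 1`, for `|k|, |k − 1| ≤ K` on the diamond of layer
`max`. [folklore] -/
theorem lowerParityFin_eq_par_below {n K R : ℕ} {g₀ : ZFrame} (h₀ : IsFrame (Pc g₀.pt) g₀.t₁ g₀.t₂ g₀.U)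
    (h₀S : g₀.pt ∈ S (n + K + 4 + R)) (h₀p : frameParity g₀.t₁ g₀.t₂ g₀.U = 1)
    (h₀A : (∀ m, ∀ z ∈ S m, Pc z = fcc3Int) ∨ Pc g₀.pt = hcpInt) (hKR : 3 * K ≤ R)
    (k : ℤ) (hk : k.natAbs ≤ K) (hk' : (k - 1).natAbs ≤ K) (i j : ℤ)
    (hij : j.natAbs + i.natAbs + 3 * k.natAbs ≤ R) (hij' : j.natAbs + i.natAbs + 3 * (k - 1).natAbs ≤ R) :
    lowerParity (frameAt Pc nb g₀ k i j).t₁ (frameAt Pc nb g₀ k i j).t₂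
        (lowerCap (Pc (frameAt Pc nb g₀ k i j).pt) (frameAt Pc nb g₀ k i j).t₁ (frameAt Pc nb g₀ k i j).t₂ (frameAt Pc nb g₀ k i j).U) =
      frameParity (frameAt Pc nb g₀ (k - 1) i j).t₁ (frameAt Pc nb g₀ (k - 1) i j).t₂ (frameAt Pc nb g₀ (k - 1) i j).U := by
  rcases int_cases' k with ⟨m, rfl⟩ | ⟨m, rfl⟩
  · have habs : ((m : ℤ) + 1).natAbs = m + 1 := Int.natAbs_natCast (m + 1)
    have habs' : ((m : ℤ) + 1 - 1).natAbs = m := by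
      rw [add_sub_cancel_right]; exact Int.natAbs_natCast m
    rw [habs] at hk hij
    rw [habs'] at hk' hij'
    have := (layersUpFin hch h₀ h₀S h₀p h₀A hKR m hk').2 i j (by omega) (by omega)
    rw [show (m : ℤ) + 1 - 1 = (m : ℤ) by ring]
    exact this
  · have habs : (-(m : ℤ)).natAbs = m := by rw [Int.natAbs_neg]; exact Int.natAbs_natCast m
    have habs' : (-(m : ℤ) - 1).natAbs = m + 1 := by
      rw [show -(m : ℤ) - 1 = -((m : ℤ) + 1) by ring, Int.natAbs_neg]; exact Int.natAbs_natCast (m + 1)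
    rw [habs] at hk hij
    rw [habs'] at hk' hij'
    have := (layersDownFin hch h₀ h₀S h₀p h₀A hKR m hk).2 i j (by omega) (by omega)
    rw [show -(m : ℤ) - 1 = -((m : ℤ) + 1) by ring]
    exact this.symm

/-- **Level of a developed frame** (corollary used as the registered anchor): the frame
`frameAt g₀ k i j` of layer `k ≤ K`, `|j| + |i| + 3k ≤ R`, is at level
`n + (K − k) + (R − |j| − |i|) + 4`. [folklore] -/
theorem layersUpFin_mem {n K R : ℕ} {g₀ : ZFrame} (h₀ : IsFrame (Pc g₀.pt) g₀.t₁ g₀.t₂ g₀.U)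
    (h₀S : g₀.pt ∈ S (n + K + 4 + R)) (h₀p : frameParity g₀.t₁ g₀.t₂ g₀.U = 1)
    (h₀A : (∀ m, ∀ z ∈ S m, Pc z = fcc3Int) ∨ Pc g₀.pt = hcpInt) (hKR : 3 * K ≤ R)
    (k : ℕ) (hk : k ≤ K) (i j : ℤ) (hij : j.natAbs + i.natAbs + 3 * k ≤ R) :
    (frameAt Pc nb g₀ (k : ℤ) i j).pt ∈ S (n + (K - k) + (R - j.natAbs - i.natAbs) + 4) :=
  (((layersUpFin hch h₀ h₀S h₀p h₀A hKR k hk).1).1 i j hij).2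

/-! ## Registered anchor (closed form) -/

omit hch in
/-- **Closed form of `layersUpFin_mem`** (the registered anchor of this file): the section data
`S, B, Pc, nb` and the standing hypothesis written out (two hypotheses regrouped). [folklore] -/
theorem layersUpFin_mem_graded :
    ∀ {S : ℕ → Set (EuclideanSpace ℝ (Fin 3))} {B : EuclideanSpace ℝ (Fin 3) → EuclideanSpace ℝ
    (Fin 3) → Prop} {Pc : EuclideanSpace ℝ (Fin 3) → Finset (Fin 3 → ℤ)} {nb : EuclideanSpace ℝ
    (Fin 3) → (Fin 3 → ℤ) → EuclideanSpace ℝ (Fin 3)}, ((∀ n : ℕ, ∀ z ∈ S n, (Pc z =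
    Summit.AtomisticToContinuum.Crystallization.Theorems.PalmUnimodularRigidityShellsToBarlowChart.fcc3Int
    ∨ Pc z = Literature.Geometry.DiscreteGeometry.hcpInt) ∧ Set.BijOn (nb z) (↑(Pc z) : Set (Fin
    3 → ℤ)) {y | B z y} ∧ ∀ t ∈ Pc z, ∀ t' ∈ Pc z, (B (nb z t) (nb z t') ↔
    Literature.Geometry.DiscreteGeometry.sqNormInt (t - t') = 18)) ∧ (∀ n : ℕ, ∀ z ∈ S (n + 1),
    ∀ y, B z y → y ∈ S n) ∧ (∀ n m : ℕ, ∀ x ∈ S n, ∀ y ∈ S m, B x y → ∀ (z z' : EuclideanSpace ℝ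
    (Fin 3)) (t t' u u' : Fin 3 → ℤ), (t = 0 ∧ z = x ∨ t ∈ Pc x ∧ z = nb x t) → (t' = 0 ∧ z' = x
    ∨ t' ∈ Pc x ∧ z' = nb x t') → (u = 0 ∧ z = y ∨ u ∈ Pc y ∧ z = nb y u) → (u' = 0 ∧ z' = y ∨
    u' ∈ Pc y ∧ z' = nb y u') → Literature.Geometry.DiscreteGeometry.sqNormInt (u - u') =
    Literature.Geometry.DiscreteGeometry.sqNormInt (t - t')) ∧ (∀ x y, B x y → B y x)) → ∀ {n K
    R : ℕ} {g₀ :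
    Summit.AtomisticToContinuum.Crystallization.Theorems.PalmUnimodularRigidityShellsToBarlowChart.ZFrame}
    (k : ℕ) (i j : ℤ), g₀.pt ∈ S (n + K + 4 + R) →
    Summit.AtomisticToContinuum.Crystallization.Theorems.PalmUnimodularRigidityShellsToBarlowChart.IsFrame
    (Pc g₀.pt) g₀.t₁ g₀.t₂ g₀.U →
    Summit.AtomisticToContinuum.Crystallization.Theorems.PalmUnimodularRigidityShellsToBarlowChart.frameParity
    g₀.t₁ g₀.t₂ g₀.U = 1 → (∀ m, ∀ z ∈ S m, Pc z =
    Summit.AtomisticToContinuum.Crystallization.Theorems.PalmUnimodularRigidityShellsToBarlowChart.fcc3Int)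
    ∨ Pc g₀.pt = Literature.Geometry.DiscreteGeometry.hcpInt → 3 * K ≤ R → k ≤ K → j.natAbs +
    i.natAbs + 3 * k ≤ R → (frameAt Pc nb g₀ (k : ℤ) i j).pt ∈ S (n + (K - k) + (R - j.natAbs -
    i.natAbs) + 4) := by
  intro S B Pc nb hch n K R g₀ k i j h₀S h₀ h₀p h₀A hKR hk hij
  exact layersUpFin_mem hch h₀ h₀S h₀p h₀A hKR k hk i j hij

end Summit.AtomisticToContinuum.Crystallization.Theorems.SquareWellLayerCakeGapTwelveToBarlow

end
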